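import Mathlib
import Literature.Analysis.UnboundedOperators.ConjugateOperatorRegularity
import HarnessLib

/-!
# Stub `stub_mourreThresholdLAP` — Mourre LAP infrastructure 7: regularity algebra I (`C¹`, Lipschitz)

Item `stmt-AtomisticToContinuum-12594` (crux `MourreDissolution` of route `EmbeddedDrudeMourre`,
sub-problem `FouriersLaw`), line `separable-vertex-faddeev-pair-sector`, stub S6
`stub_mourreThresholdLAP` (Mourre's limiting absorption principle; NOT in the tree). Step L2 of the
proof map, pure `C¹(A; H)` / `𝒞^{1,1}(A; H)` algebra over the tree's `ConjugateOperatorRegularity`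
(ABG = Amrein–Boutet de Monvel–Georgescu 1996, §5.1–5.2).

* §1 `C¹(A; H)` is stable under inverses: `[S⁻¹, iA] = -S⁻¹ [S, iA] S⁻¹` (ABG Prop. 5.1.6 /
  (6.2.7); headline `isOfClassC1_inverse_rule`), strong continuity of `x ↦ 𝒲(x)[S] f` everywhere,
  the Lipschitz bound `‖𝒲(x)[S] - S‖ ≤ |x| ‖[S, iA]‖` (mean value inequality) and
  `‖[𝒲(x) - 1]² S‖ ≤ 2|x| ‖[S, iA]‖`;
* §2 measurability of the `𝒞^{1,1}` integrand (the operator norm of a strongly continuous family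
  is lower semicontinuous — the remark after ABG (5.2.1));
* §3 `𝒞^{1,1}(A; H)` is a vector space, and comparison lemmas (`isOfClassC11_of_le`,
  `isOfClassC11_of_le₂`) feeding the product and inverse rules of `…LAPRegularityAlgebraMul`.
-/


noncomputable section

open MeasureTheory Complex Filter Topology Set
open scoped InnerProductSpace ComplexConjugate ENNReal NNReal

namespace Summit.AtomisticToContinuum.FouriersLaw.Theorems.MourreDissolution

open Literature.Analysis.UnboundedOperators
open Literature.Analysis.UnboundedOperators.UnitaryRep

variable {H : Type*} [NormedAddCommGroup H] [InnerProductSpace ℂ H] [CompleteSpace H]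

/-! ## §1. Inverses in `C¹(A; H)`, strong continuity, and the Lipschitz bound -/

/-- `𝒲(x)` preserves inverse pairs: `𝒲(x)[S] 𝒲(x)[T] = 1` if `S T = 1`. [folklore] -/
theorem conjAut_mul_conjAut_eq_one (A : OneParameterUnitaryGroup H) {S T : H →L[ℂ] H}
    (hST : S * T = 1) (x : ℝ) : A.conjAut x S * A.conjAut x T = 1 := by
  rw [← conjAut_mul, hST, conjAut_one]

/-- **`C¹(A; H)` is stable under inverses** (ABG Prop. 5.1.6 (b) ⇒ (a), `k = 1`; the identity
(6.2.7) `[R, A] = R [A, S] R` for `R = S⁻¹`): if `x ↦ 𝒲(x)[S]` has strong derivative `D = [S, iA]`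
at `0` and `T` is a two-sided bounded inverse of `S`, then `x ↦ 𝒲(x)[T]` has strong derivative
`-T D T` at `0`. Proof: `𝒲(x)[T] f = T f + 𝒲(x)[T] (S - 𝒲(x)[S]) T f` and the strong product rule.
[cite: AmreinBoutetdeMonvelGeorgescu1996, Prop. 5.1.6] -/
theorem hasCommutator_inverse {A : OneParameterUnitaryGroup H} {S T D : H →L[ℂ] H}
    (h : A.HasCommutator S D) (hST : S * T = 1) (hTS : T * S = 1) :
    A.HasCommutator T (-(T * D * T)) := by
  intro f
  -- `𝒲(x)[T] f = T f + 𝒲(x)[T] ((S - 𝒲(x)[S]) (T f))`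
  have key : ∀ x : ℝ, A.conjAut x T f = T f + A.conjAut x T ((S - A.conjAut x S) (T f)) := by
    intro x
    have h1 : A.conjAut x T (A.conjAut x S (T f)) = T f := by
      rw [← mul_apply_eq_comp (A.conjAut x T), ← conjAut_mul, hTS, conjAut_one, one_apply_eq_self]
    have h2 : S (T f) = f := by rw [← mul_apply_eq_comp S, hST, one_apply_eq_self]
    rw [_root_.sub_apply, map_sub, h1, h2]
    abel
  -- the strong product rule for `F(x) = 𝒲(x)[T]`, `u(x) = (S - 𝒲(x)[S]) (T f)`, `u(0) = 0`
  have hu : HasDerivAt (fun x : ℝ => (S - A.conjAut x S) (T f)) (-(D (T f))) 0 := by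
    have := (h (T f)).const_sub (S (T f))
    simpa [_root_.sub_apply] using this
  have hFu : HasDerivAt (fun x : ℝ => A.conjAut x T (0 : H)) (0 : H) 0 := by
    simp only [map_zero]
    exact hasDerivAt_const _ _
  have hcont : Tendsto (fun x : ℝ => A.conjAut x T (-(D (T f)))) (𝓝 0)
      (𝓝 (A.conjAut 0 T (-(D (T f))))) := by
    simpa using A.tendsto_conjAut_apply T (-(D (T f)))
  have hprod := hasDerivAt_apply_of_strongDeriv (F := fun x => A.conjAut x T)
    (u := fun x : ℝ => (S - A.conjAut x S) (T f)) hFu hcont (fun x => A.norm_conjAut_le x T) hu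
    (by simp)
  simp only [conjAut_zero, zero_add, map_neg] at hprod
  have hsum := (hasDerivAt_const (0 : ℝ) (T f)).add hprod
  simp only [zero_add] at hsum
  refine (hsum.congr_of_eventuallyEq (Eventually.of_forall fun x => key x)).congr_deriv ?_
  simp [mul_apply_eq_comp]

/-- `C¹(A; H)` is stable under inverses. [cite: AmreinBoutetdeMonvelGeorgescu1996, Prop. 5.1.6] -/
theorem isOfClassC1_inverse {A : OneParameterUnitaryGroup H} {S T : H →L[ℂ] H}
    (h : A.IsOfClassC1 S) (hST : S * T = 1) (hTS : T * S = 1) : A.IsOfClassC1 T := by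
  obtain ⟨D, hD⟩ := h
  exact (hasCommutator_inverse hD hST hTS).isOfClassC1

/-- **`[S⁻¹, iA] = -S⁻¹ [S, iA] S⁻¹`.** [cite: AmreinBoutetdeMonvelGeorgescu1996, Prop. 5.1.6] -/
theorem commutatorCLM_inverse {A : OneParameterUnitaryGroup H} {S T : H →L[ℂ] H}
    (h : A.IsOfClassC1 S) (hST : S * T = 1) (hTS : T * S = 1) :
    A.commutatorCLM T = -(T * A.commutatorCLM S * T) :=
  (hasCommutator_inverse h.hasCommutator hST hTS).commutatorCLM_eq

/-- **Strong continuity of `x ↦ 𝒲(x)[S] f` at every point** (group law + continuity at `0`).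
[folklore] -/
theorem continuous_conjAut_apply (A : OneParameterUnitaryGroup H) (S : H →L[ℂ] H) (f : H) :
    Continuous fun x : ℝ => A.conjAut x S f := by
  refine continuous_iff_continuousAt.2 fun x₀ => ?_
  have key : ∀ x : ℝ, A.conjAut x S f =
      A.appReal (-x₀) (A.conjAut (x - x₀) S (A.appReal x₀ f)) := by
    intro x
    rw [← conjAut_apply, ← conjAut_add, add_sub_cancel]
  have h0 : Tendsto (fun x : ℝ => x - x₀) (𝓝 x₀) (𝓝 0) := by
    simpa using (tendsto_id (x := 𝓝 x₀)).sub_const x₀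
  have h1 := (A.tendsto_conjAut_apply S (A.appReal x₀ f)).comp h0
  have h2 := ((A.appReal (-x₀)).continuous.tendsto _).comp h1
  rw [ContinuousAt, conjAut_apply]
  refine h2.congr fun x => ?_
  simp only [Function.comp_apply]
  exact (key x).symm

/-- **Lipschitz bound** `‖𝒲(x)[S] f - S f‖ ≤ |x| ‖[S, iA]‖ ‖f‖` (mean value inequality for
`y ↦ 𝒲(y)[S] f`, whose derivative `𝒲(y)[D] f` has norm `≤ ‖D‖ ‖f‖`).
[cite: AmreinBoutetdeMonvelGeorgescu1996, Prop. 5.1.2] -/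
theorem norm_conjAut_apply_sub_le {A : OneParameterUnitaryGroup H} {S D : H →L[ℂ] H}
    (h : A.HasCommutator S D) (x : ℝ) (f : H) :
    ‖A.conjAut x S f - S f‖ ≤ |x| * ‖D‖ * ‖f‖ := by
  have hderiv : ∀ y ∈ (Set.univ : Set ℝ), HasDerivWithinAt (fun y : ℝ => A.conjAut y S f)
      (A.conjAut y D f) Set.univ y := fun y _ => (h.hasDerivAt_conjAut y f).hasDerivWithinAt
  have hbound : ∀ y ∈ (Set.univ : Set ℝ), ‖A.conjAut y D f‖ ≤ ‖D‖ * ‖f‖ := fun y _ => by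
    calc ‖A.conjAut y D f‖ ≤ ‖A.conjAut y D‖ * ‖f‖ := ContinuousLinearMap.le_opNorm _ _
      _ = ‖D‖ * ‖f‖ := by rw [norm_conjAut]
  have := convex_univ.norm_image_sub_le_of_norm_hasDerivWithin_le hderiv hbound
    (Set.mem_univ 0) (Set.mem_univ x)
  simp only [conjAut_zero, sub_zero, Real.norm_eq_abs] at this
  calc ‖A.conjAut x S f - S f‖ ≤ ‖D‖ * ‖f‖ * |x| := this
    _ = |x| * ‖D‖ * ‖f‖ := by ring

/-- **Lipschitz bound in operator norm**: `‖𝒲(x)[S] - S‖ ≤ |x| ‖[S, iA]‖`.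
[cite: AmreinBoutetdeMonvelGeorgescu1996, Prop. 5.1.2] -/
theorem norm_conjAut_sub_le {A : OneParameterUnitaryGroup H} {S D : H →L[ℂ] H}
    (h : A.HasCommutator S D) (x : ℝ) : ‖A.conjAut x S - S‖ ≤ |x| * ‖D‖ :=
  ContinuousLinearMap.opNorm_le_bound _ (by positivity) fun f => by
    simpa [_root_.sub_apply] using norm_conjAut_apply_sub_le h x f

/-- `‖[𝒲(x) - 1]² S‖ ≤ 2 ‖𝒲(x)[S] - S‖`. [folklore] -/
theorem norm_secondDifference_le (A : OneParameterUnitaryGroup H) (x : ℝ) (S : H →L[ℂ] H) :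
    ‖A.secondDifference x S‖ ≤ 2 * ‖A.conjAut x S - S‖ := by
  rw [secondDifference_eq]
  calc ‖A.conjAut x (A.conjAut x S - S) - (A.conjAut x S - S)‖
      ≤ ‖A.conjAut x (A.conjAut x S - S)‖ + ‖A.conjAut x S - S‖ := norm_sub_le _ _
    _ = 2 * ‖A.conjAut x S - S‖ := by rw [norm_conjAut]; ring

/-- `‖[𝒲(x) - 1]² S‖ ≤ 2 |x| ‖[S, iA]‖` for `S ∈ C¹(A; H)`. [folklore] -/
theorem norm_secondDifference_le_of_hasCommutator {A : OneParameterUnitaryGroup H} {S D : H →L[ℂ] H}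
    (h : A.HasCommutator S D) (x : ℝ) : ‖A.secondDifference x S‖ ≤ 2 * (|x| * ‖D‖) :=
  (norm_secondDifference_le A x S).trans (by gcongr; exact norm_conjAut_sub_le h x)

/-- `‖[𝒲(x) - 1]² S‖ ≤ 4 ‖S‖` (each term is an isometric image of `S`). [folklore] -/
theorem norm_secondDifference_le_four_mul (A : OneParameterUnitaryGroup H) (x : ℝ)
    (S : H →L[ℂ] H) : ‖A.secondDifference x S‖ ≤ 4 * ‖S‖ := by
  refine (norm_secondDifference_le A x S).trans ?_
  have : ‖A.conjAut x S - S‖ ≤ ‖S‖ + ‖S‖ :=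
    (norm_sub_le _ _).trans (by rw [norm_conjAut])
  linarith

/-! ## §2. Measurability of the `𝒞^{1,1}` integrand -/

omit [CompleteSpace H] in
/-- **The operator norm of a strongly continuous family is lower semicontinuous** (a supremum of
the continuous functions `x ↦ ‖F(x) f‖`, `‖f‖ ≤ 1`; the remark after ABG (5.2.1)). [folklore] -/
theorem lowerSemicontinuous_norm_of_continuous_apply {F : ℝ → H →L[ℂ] H}
    (hF : ∀ f, Continuous fun x => F x f) : LowerSemicontinuous fun x => ‖F x‖ := by
  intro x₀ y hy
  rcases le_or_gt 0 y with hy0 | hy0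
  swap
  · exact Eventually.of_forall fun x => hy0.trans_le (norm_nonneg _)
  obtain ⟨f, hf⟩ : ∃ f, y * ‖f‖ < ‖F x₀ f‖ := by
    by_contra hcon
    have hcon' : ∀ f, ‖F x₀ f‖ ≤ y * ‖f‖ := fun f => not_lt.1 fun hf => hcon ⟨f, hf⟩
    exact absurd (ContinuousLinearMap.opNorm_le_bound _ hy0 hcon') (not_le.2 hy)
  have hev : ∀ᶠ x in 𝓝 x₀, y * ‖f‖ < ‖F x f‖ :=
    ((hF f).norm.tendsto x₀).eventually (lt_mem_nhds hf)
  filter_upwards [hev] with x hx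
  refine lt_of_not_ge fun hcon => ?_
  have h1 : ‖F x f‖ ≤ ‖F x‖ * ‖f‖ := ContinuousLinearMap.le_opNorm _ _
  have h2 : ‖F x‖ * ‖f‖ ≤ y * ‖f‖ := mul_le_mul_of_nonneg_right hcon (norm_nonneg _)
  linarith

/-- `x ↦ ‖[𝒲(x) - 1]² S‖` is lower semicontinuous, hence measurable. [folklore] -/
theorem measurable_norm_secondDifference (A : OneParameterUnitaryGroup H) (S : H →L[ℂ] H) :
    Measurable fun x : ℝ => ‖A.secondDifference x S‖ := by
  refine (lowerSemicontinuous_norm_of_continuous_apply fun f => ?_).measurable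
  simp only [secondDifference, _root_.add_apply, _root_.sub_apply, FunLike.coe_smul, Pi.smul_apply]
  exact (((continuous_conjAut_apply A S f).comp (continuous_const.mul continuous_id)).sub
    ((continuous_conjAut_apply A S f).const_smul (2 : ℂ))).add continuous_const

/-- The `𝒞^{1,1}` integrand `x ↦ ‖[𝒲(x) - 1]² S‖ / x²` (as an `ℝ≥0∞`-valued function) is
measurable. [folklore] -/
theorem measurable_c11Integrand (A : OneParameterUnitaryGroup H) (S : H →L[ℂ] H) :
    Measurable fun x : ℝ => ENNReal.ofReal (‖A.secondDifference x S‖ / x ^ 2) :=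
  ENNReal.measurable_ofReal.comp
    ((measurable_norm_secondDifference A S).div (measurable_id.pow_const 2))

/-! ## §3. `𝒞^{1,1}(A; H)`: vector space, algebra, inverses -/

/-- `[𝒲(x) - 1]²` is additive in the operator. [folklore] -/
theorem secondDifference_add_op (A : OneParameterUnitaryGroup H) (x : ℝ) (S T : H →L[ℂ] H) :
    A.secondDifference x (S + T) = A.secondDifference x S + A.secondDifference x T := by
  simp only [secondDifference, conjAut_add_op, smul_add]
  abel

/-- `[𝒲(x) - 1]²` is homogeneous in the operator. [folklore] -/
theorem secondDifference_smul_op (A : OneParameterUnitaryGroup H) (x : ℝ) (c : ℂ)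
    (S : H →L[ℂ] H) : A.secondDifference x (c • S) = c • A.secondDifference x S := by
  simp only [secondDifference, conjAut_smul_op, smul_add, smul_sub, smul_comm (2 : ℂ) c]

/-- **`𝒞^{1,1}(A; H)` is closed under sums.** [cite: AmreinBoutetdeMonvelGeorgescu1996, §5.2 eq. (5.2.4)] -/
theorem isOfClassC11_add {A : OneParameterUnitaryGroup H} {S T : H →L[ℂ] H}
    (hS : A.IsOfClassC11 S) (hT : A.IsOfClassC11 T) : A.IsOfClassC11 (S + T) := by
  unfold IsOfClassC11 at *
  calc ∫⁻ x in Set.Icc (-1 : ℝ) 1, ENNReal.ofReal (‖A.secondDifference x (S + T)‖ / x ^ 2)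
      ≤ ∫⁻ x in Set.Icc (-1 : ℝ) 1, (ENNReal.ofReal (‖A.secondDifference x S‖ / x ^ 2) +
          ENNReal.ofReal (‖A.secondDifference x T‖ / x ^ 2)) := by
        refine lintegral_mono fun x => ?_
        rw [secondDifference_add_op, ← ENNReal.ofReal_add (by positivity) (by positivity),
          ← add_div]
        exact ENNReal.ofReal_le_ofReal
          (div_le_div_of_nonneg_right (norm_add_le _ _) (sq_nonneg _))
    _ = (∫⁻ x in Set.Icc (-1 : ℝ) 1, ENNReal.ofReal (‖A.secondDifference x S‖ / x ^ 2)) +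
          ∫⁻ x in Set.Icc (-1 : ℝ) 1, ENNReal.ofReal (‖A.secondDifference x T‖ / x ^ 2) :=
        lintegral_add_left (measurable_c11Integrand A S) _
    _ < ⊤ := ENNReal.add_lt_top.2 ⟨hS, hT⟩

/-- **`𝒞^{1,1}(A; H)` is closed under scalar multiples.**
[cite: AmreinBoutetdeMonvelGeorgescu1996, §5.2 eq. (5.2.4)] -/
theorem isOfClassC11_smul {A : OneParameterUnitaryGroup H} {S : H →L[ℂ] H}
    (hS : A.IsOfClassC11 S) (c : ℂ) : A.IsOfClassC11 (c • S) := by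
  unfold IsOfClassC11 at *
  have h : ∀ x : ℝ, ENNReal.ofReal (‖A.secondDifference x (c • S)‖ / x ^ 2) =
      ENNReal.ofReal ‖c‖ * ENNReal.ofReal (‖A.secondDifference x S‖ / x ^ 2) := fun x => by
    rw [secondDifference_smul_op, norm_smul, mul_div_assoc, ENNReal.ofReal_mul (norm_nonneg _)]
  simp_rw [h]
  rw [lintegral_const_mul _ (measurable_c11Integrand A S)]
  exact ENNReal.mul_lt_top ENNReal.ofReal_lt_top hS

/-- `𝒞^{1,1}(A; H)` is closed under negation. [folklore] -/
theorem isOfClassC11_neg {A : OneParameterUnitaryGroup H} {S : H →L[ℂ] H}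
    (hS : A.IsOfClassC11 S) : A.IsOfClassC11 (-S) := by
  simpa using isOfClassC11_smul hS (-1)

/-- `𝒞^{1,1}(A; H)` is closed under differences. [folklore] -/
theorem isOfClassC11_sub {A : OneParameterUnitaryGroup H} {S T : H →L[ℂ] H}
    (hS : A.IsOfClassC11 S) (hT : A.IsOfClassC11 T) : A.IsOfClassC11 (S - T) := by
  simpa [sub_eq_add_neg] using isOfClassC11_add hS (isOfClassC11_neg hT)

/-- A pointwise bound `‖[𝒲(x)-1]² T‖/x² ≤ a ‖[𝒲(x)-1]² S‖/x² + b` on `[-1, 1]` by a `𝒞^{1,1}`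
operator `S` and a constant gives `T ∈ 𝒞^{1,1}(A; H)`. [folklore] -/
theorem isOfClassC11_of_le {A : OneParameterUnitaryGroup H} {S T : H →L[ℂ] H}
    (hS : A.IsOfClassC11 S) {a b : ℝ} (ha : 0 ≤ a) (hb : 0 ≤ b)
    (hle : ∀ x ∈ Set.Icc (-1 : ℝ) 1, ‖A.secondDifference x T‖ / x ^ 2 ≤
      a * (‖A.secondDifference x S‖ / x ^ 2) + b) : A.IsOfClassC11 T := by
  unfold IsOfClassC11 at *
  calc ∫⁻ x in Set.Icc (-1 : ℝ) 1, ENNReal.ofReal (‖A.secondDifference x T‖ / x ^ 2)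
      ≤ ∫⁻ x in Set.Icc (-1 : ℝ) 1, (ENNReal.ofReal a *
          ENNReal.ofReal (‖A.secondDifference x S‖ / x ^ 2) + ENNReal.ofReal b) := by
        refine setLIntegral_mono' measurableSet_Icc fun x hx => ?_
        rw [← ENNReal.ofReal_mul ha, ← ENNReal.ofReal_add (by positivity) hb]
        exact ENNReal.ofReal_le_ofReal (hle x hx)
    _ = ENNReal.ofReal a * (∫⁻ x in Set.Icc (-1 : ℝ) 1,
          ENNReal.ofReal (‖A.secondDifference x S‖ / x ^ 2)) +
          ENNReal.ofReal b * volume (Set.Icc (-1 : ℝ) 1) := by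
        rw [lintegral_add_left ((measurable_c11Integrand A S).const_mul _), setLIntegral_const,
          lintegral_const_mul _ (measurable_c11Integrand A S)]
    _ < ⊤ := by
        refine ENNReal.add_lt_top.2 ⟨ENNReal.mul_lt_top ENNReal.ofReal_lt_top hS,
          ENNReal.mul_lt_top ENNReal.ofReal_lt_top ?_⟩
        rw [Real.volume_Icc]
        exact ENNReal.ofReal_lt_top

/-- A pointwise bound by two `𝒞^{1,1}` operators and a constant gives `𝒞^{1,1}`. [folklore] -/
theorem isOfClassC11_of_le₂ {A : OneParameterUnitaryGroup H} {S₁ S₂ T : H →L[ℂ] H}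
    (h₁ : A.IsOfClassC11 S₁) (h₂ : A.IsOfClassC11 S₂) {a₁ a₂ b : ℝ} (ha₁ : 0 ≤ a₁) (ha₂ : 0 ≤ a₂)
    (hb : 0 ≤ b)
    (hle : ∀ x ∈ Set.Icc (-1 : ℝ) 1, ‖A.secondDifference x T‖ / x ^ 2 ≤
      a₁ * (‖A.secondDifference x S₁‖ / x ^ 2) + a₂ * (‖A.secondDifference x S₂‖ / x ^ 2) + b) :
    A.IsOfClassC11 T := by
  unfold IsOfClassC11 at *
  calc ∫⁻ x in Set.Icc (-1 : ℝ) 1, ENNReal.ofReal (‖A.secondDifference x T‖ / x ^ 2)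
      ≤ ∫⁻ x in Set.Icc (-1 : ℝ) 1, (ENNReal.ofReal a₁ *
          ENNReal.ofReal (‖A.secondDifference x S₁‖ / x ^ 2) + (ENNReal.ofReal a₂ *
          ENNReal.ofReal (‖A.secondDifference x S₂‖ / x ^ 2) + ENNReal.ofReal b)) := by
        refine setLIntegral_mono' measurableSet_Icc fun x hx => ?_
        rw [← ENNReal.ofReal_mul ha₁, ← ENNReal.ofReal_mul ha₂,
          ← ENNReal.ofReal_add (by positivity) hb, ← ENNReal.ofReal_add (by positivity)
          (by positivity), ← add_assoc]
        exact ENNReal.ofReal_le_ofReal (hle x hx)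
    _ = ENNReal.ofReal a₁ * (∫⁻ x in Set.Icc (-1 : ℝ) 1,
          ENNReal.ofReal (‖A.secondDifference x S₁‖ / x ^ 2)) +
        (ENNReal.ofReal a₂ * (∫⁻ x in Set.Icc (-1 : ℝ) 1,
          ENNReal.ofReal (‖A.secondDifference x S₂‖ / x ^ 2)) +
          ENNReal.ofReal b * volume (Set.Icc (-1 : ℝ) 1)) := by
        rw [lintegral_add_left ((measurable_c11Integrand A S₁).const_mul _),
          lintegral_add_left ((measurable_c11Integrand A S₂).const_mul _), setLIntegral_const,
          lintegral_const_mul _ (measurable_c11Integrand A S₁),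
          lintegral_const_mul _ (measurable_c11Integrand A S₂)]
    _ < ⊤ := by
        refine ENNReal.add_lt_top.2 ⟨ENNReal.mul_lt_top ENNReal.ofReal_lt_top h₁,
          ENNReal.add_lt_top.2 ⟨ENNReal.mul_lt_top ENNReal.ofReal_lt_top h₂,
          ENNReal.mul_lt_top ENNReal.ofReal_lt_top ?_⟩⟩
        rw [Real.volume_Icc]
        exact ENNReal.ofReal_lt_top

/-! ## §4. Headline (registered helper stub) -/

/-- **Inverse rule in `C¹(A; H)`, headline form** (all binders explicit; registered helper stub of
`stub_mourreThresholdLAP`): a two-sided bounded inverse `T` of `S ∈ C¹(A; H)` is in `C¹(A; H)`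
with `[T, iA] = -T [S, iA] T`. [cite: AmreinBoutetdeMonvelGeorgescu1996, Prop. 5.1.6] -/
theorem isOfClassC1_inverse_rule :
    ∀ (K : Type) [NormedAddCommGroup K] [InnerProductSpace ℂ K] [CompleteSpace K]
      (A : Literature.Analysis.UnboundedOperators.OneParameterUnitaryGroup K) (S T : K →L[ℂ] K),
      A.IsOfClassC1 S → S * T = 1 → T * S = 1 →
        A.IsOfClassC1 T ∧ A.commutatorCLM T = -(T * A.commutatorCLM S * T) := by
  intro K _ _ _ A S T h hST hTS
  exact ⟨isOfClassC1_inverse h hST hTS, commutatorCLM_inverse h hST hTS⟩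

end Summit.AtomisticToContinuum.FouriersLaw.Theorems.MourreDissolution
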